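import Literature.MathematicalPhysics.KineticTheory.HardSphereEulerPrimitiveForm
import Literature.Analysis.FunctionSpaces.TorusSpaceTime
import HarnessLib

/-!
# The Euler streaming identity in entropy variables (stub `stub_streaming`)

Crux `Summit.AtomisticToContinuum.HydrodynamicLimit.Theses.OneFlightGossipEngine.ClampedCurrentsDock`
(stmt-AtomisticToContinuum-14680), line `IdeatorTwoSketch`, stub S3
`stub_streaming : EulerStreamingIdentity` — step (ii) of Yau's relative-entropy clock ("Euler in
entropy variables"). The one-body exponent of the local Gibbs reference is
`g_t(x,v) = log a_t(x) − (3/2) log(2π θ_t(x)) − |v − u_t(x)|² / (2 θ_t(x))`; its streaming rate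
`(∂_t + v·∇_x) g`, computed by the chain rule and the PRIMITIVE hard-sphere Euler equations
(`IsHardSphereEulerSolution.timeDeriv_density_eq / density_mul_timeDeriv_velocity_eq /
timeDeriv_temperature_eq`, `Literature/MathematicalPhysics/KineticTheory/HardSphereEulerPrimitiveForm`),
splits EXACTLY into the order-zero term `∂_t log a + u·∇log a + ζ div u`, the activity bracket
`w·[∇log a − (ζ + ρζ′)∇ρ/ρ] + (1 − ζ)(w·∇θ)/θ`, the traceless kinetic stress
`θ⁻¹ Σ (w_j w_k − δ_jk |w|²/3) ∂_k u_j + (1 − ζ)|w|² div u /(3θ)` and the fast heat flux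
`(|w|² − 5θ)(w·∇θ)/(2θ²)`, `w = v − u_t(x)`. The statement `EulerStreamingIdentity` is re-declared
verbatim from the line skeleton `Cruxes/ClampedCurrentsDock/Lines/IdeatorTwoSketch.lean`.

Proof: with `D = ∂_t + v·∇` acting on the fields (`v` fixed),
`Dg = D log a − (3/2) Dθ/θ + Σ_j w_j Du_j/θ + |w|² Dθ/(2θ²)` (product / chain rules along coordinate
lines `HsEulerCalc.hasDerivAt_coordLine` and time slices `IsSmoothSpaceTimeOn.hasDerivWithinAt_slice`,
read off by `HsEulerCalc.partialDeriv_eq_of_hasDerivAt / timeDerivWithin_eq_of_hasDerivWithinAt`);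
then `Dθ = w·∇θ − (2/3)θζ div u`, `Du_j = w·∇u_j − θ(ζ + ρζ′)∂_jρ/ρ − ζ∂_jθ` (primitive equations,
`ρ > 0`) and `field_simp; ring`.
-/

noncomputable section

namespace Summit.AtomisticToContinuum.HydrodynamicLimit.Theorems.ClampedCurrentsDockStreaming

open scoped BigOperators
open MeasureTheory Filter Set Topology
open Literature.MathematicalPhysics.KineticTheory Literature.Analysis.FluidPDE Literature.Analysis.FunctionSpaces
open Literature.MathematicalPhysics.KineticTheory.HsEulerCalc

/-! ## The statement (verbatim from the line skeleton) -/

/-- **S3 — Euler cancellation, kinetic part: the streaming rate of the local-Gibbs exponent in entropy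
variables.** For a classical hs-Euler solution on `[0,T)` whose pressure is `ρθζ(ρ)` (`ζ` smooth on an open
set containing the density values; for hard spheres `ζ r = Z(rσ³)` by `hsCompressibility_eq` at small packing)
and ANY activity field `a > 0` jointly smooth on `[0,T) × 𝕋³`, with `w = v − u_t(x)`, the streaming rate
`(∂_t + v·∇)g_t(x,v)` of the exponent of S2 equals, pointwise on `[0,T) × 𝕋³ × ℝ³`,
`[∂_t log a + u·∇log a + ζ div u]` (order 0)
`+ w·[∇log a − (ζ + ρζ′)∇ρ/ρ] + (1 − ζ)(w·∇θ)/θ` (order 1)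
`+ θ⁻¹ Σ_{j,k} (w_j w_k − δ_{jk}|w|²/3) ∂_k u_j + (1 − ζ)|w|² div u/(3θ)` (order 2)
`+ (|w|² − 5θ)(w·∇θ)/(2θ²)` (order 3: the fast heat flux).
Proof: chain rule (`Dg = D log a − (3/2)Dθ/θ + Σ_j w_j Du_j/θ + |w|²Dθ/(2θ²)`) and the primitive equations
`IsHardSphereEulerSolution.timeDeriv_density_eq / density_mul_timeDeriv_velocity_eq /
timeDeriv_temperature_eq`. -/
def EulerStreamingIdentity : Prop :=
  ∀ (σ T : ℝ) (ρ θ : ℝ → T3 → ℝ) (u : ℝ → T3 → V3) (ζ : ℝ → ℝ) (J : Set ℝ) (a : ℝ → T3 → ℝ),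
    IsHardSphereEulerSolution σ T ρ u θ → IsOpen J → ContDiffOn ℝ (⊤ : ℕ∞) ζ J →
    (∀ t ∈ Ico 0 T, ∀ x, ρ t x ∈ J) →
    (∀ t ∈ Ico 0 T, ∀ x, hsPressure σ (ρ t x) (θ t x) = ρ t x * θ t x * ζ (ρ t x)) →
    Torus.IsSmoothSpaceTimeOn (Ico 0 T) a → (∀ t ∈ Ico 0 T, ∀ x, 0 < a t x) →
    ∀ t ∈ Ico 0 T, ∀ (x : T3) (v : V3),
      (let g := fun (t : ℝ) (y : T3 × V3) =>
         Real.log (a t y.1) - 3 / 2 * Real.log (2 * Real.pi * θ t y.1) - ‖y.2 - u t y.1‖ ^ 2 / (2 * θ t y.1)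
       let w : V3 := v - u t x
       let dloga := fun k : Fin 3 => Torus.partialDeriv k (fun y => Real.log (a t y)) x
       let dρ := fun k : Fin 3 => Torus.partialDeriv k (ρ t) x
       let dθ := fun k : Fin 3 => Torus.partialDeriv k (θ t) x
       let du := fun (k j : Fin 3) => Torus.partialDeriv k (fun y => u t y j) x
       let divu : ℝ := ∑ k : Fin 3, du k k
       Torus.timeDerivWithin (Ico 0 T) (fun t' y => g t' (y, v)) t x +
           ∑ k : Fin 3, v k * Torus.partialDeriv k (fun y => g t (y, v)) x =
         (Torus.timeDerivWithin (Ico 0 T) (fun t' y => Real.log (a t' y)) t x +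
             ∑ k : Fin 3, u t x k * dloga k + ζ (ρ t x) * divu) +
         (∑ k : Fin 3, w k * (dloga k - (ζ (ρ t x) + ρ t x * deriv ζ (ρ t x)) * dρ k / ρ t x) +
             (1 - ζ (ρ t x)) * (∑ k : Fin 3, w k * dθ k) / θ t x) +
         ((θ t x)⁻¹ * ∑ j : Fin 3, ∑ k : Fin 3,
               (w j * w k - (if j = k then ‖w‖ ^ 2 / 3 else 0)) * du k j +
             (1 - ζ (ρ t x)) * ‖w‖ ^ 2 * divu / (3 * θ t x)) +
         (‖w‖ ^ 2 - 5 * θ t x) * (∑ k : Fin 3, w k * dθ k) / (2 * (θ t x) ^ 2))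

/-! ## Algebraic helpers -/

/-- The traceless contraction written out: `Σ_{j,k} (w_j w_k − δ_{jk} c) M_{kj} = Σ_{j,k} w_j w_k M_{kj} − c Σ_k M_{kk}`.
[folklore] -/
theorem sum_traceless (w : V3) (c : ℝ) (M : Fin 3 → Fin 3 → ℝ) :
    ∑ j : Fin 3, ∑ k : Fin 3, (w j * w k - (if j = k then c else 0)) * M k j =
      ∑ j : Fin 3, ∑ k : Fin 3, w j * w k * M k j - c * ∑ k : Fin 3, M k k := by
  simp only [sub_mul, Finset.sum_sub_distrib, ite_mul, zero_mul, Finset.sum_ite_eq, Finset.mem_univ,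
    if_true, Finset.mul_sum]

/-! ## The stub -/

/-- **STUB `stub_streaming`** of line `IdeatorTwoSketch` (crux `ClampedCurrentsDock`, stmt-AtomisticToContinuum-14680):
the streaming rate of the local-Gibbs exponent in entropy variables along a classical hard-sphere Euler
solution (chain rule + the primitive equations of `HardSphereEulerPrimitiveForm`). [folklore] -/
theorem stub_streaming : EulerStreamingIdentity := by
  intro σ T ρ θ u ζ J a hE hJ hζ hρJ hp ha ha0 t ht x v
  dsimp only
  rw [sum_traceless]
  have hU : UniqueDiffOn ℝ (Ico (0 : ℝ) T) := uniqueDiffOn_Ico 0 T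
  -- smooth slices
  have hθ1 : Torus.IsContDiff 1 (θ t) := (hE.smooth_temperature.isSmooth_slice ht).isContDiff (by simp)
  have hu1 : Torus.IsContDiff 1 (u t) := (hE.smooth_velocity.isSmooth_slice ht).isContDiff (by simp)
  have huj1 : ∀ j, Torus.IsContDiff 1 (fun y => u t y j) := fun j => isContDiff_apply_coord hu1 j
  -- `log a` is a jointly smooth field (`a > 0`)
  have hla : Torus.IsSmoothSpaceTimeOn (Ico 0 T) (fun s y => Real.log (a s y)) :=
    ContDiffOn.log ha fun p hp => (ha0 p.1 (mem_prod.1 hp).1 _).ne'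
  have hla1 : Torus.IsContDiff 1 (fun y => Real.log (a t y)) := (hla.isSmooth_slice ht).isContDiff (by simp)
  -- positivity
  have hθ0 : ∀ y, θ t y ≠ 0 := fun y => (hE.temperature_pos t ht y).ne'
  have h2θ0 : ∀ y, 2 * θ t y ≠ 0 := fun y => mul_ne_zero two_ne_zero (hθ0 y)
  have h2πθ0 : ∀ y, 2 * Real.pi * θ t y ≠ 0 := fun y =>
    (mul_pos Real.two_pi_pos (hE.temperature_pos t ht y)).ne'
  have hθx : θ t x ≠ 0 := hθ0 x
  have hρ0 : ρ t x ≠ 0 := (hE.density_pos t ht x).ne'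
  have hπ0 : Real.pi ≠ 0 := Real.pi_pos.ne'
  -- coordinate-line derivatives of the basic fields at `x`
  have cA := fun k => hasDerivAt_coordLine hla1 x k
  have cθ := fun k => hasDerivAt_coordLine hθ1 x k
  have cu := fun k j => hasDerivAt_coordLine (huj1 j) x k
  -- time-slice derivatives at `x`
  have sA := hla.hasDerivWithinAt_slice ht x
  have sθ := hE.smooth_temperature.hasDerivWithinAt_slice ht x
  have su := fun j => (hE.smooth_velocity.apply j).hasDerivWithinAt_slice ht x
  -- `|v - u|²` in coordinates
  have hnorm : ∀ (s : ℝ) (y : T3), ‖v - u s y‖ ^ 2 =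
      (v 0 - u s y 0) ^ 2 + (v 1 - u s y 1) ^ 2 + (v 2 - u s y 2) ^ 2 := fun s y => by
    simp only [EuclideanSpace.norm_sq_eq, Fin.sum_univ_three, PiLp.sub_apply, Real.norm_eq_abs, sq_abs]
  simp only [hnorm, PiLp.sub_apply]
  -- (1) the time derivative of `g`
  have hgt : Torus.timeDerivWithin (Ico 0 T) (fun t' y => Real.log (a t' y) -
      3 / 2 * Real.log (2 * Real.pi * θ t' y) -
      ((v 0 - u t' y 0) ^ 2 + (v 1 - u t' y 1) ^ 2 + (v 2 - u t' y 2) ^ 2) / (2 * θ t' y)) t x =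
      Torus.timeDerivWithin (Ico 0 T) (fun t' y => Real.log (a t' y)) t x -
        3 / 2 * Torus.timeDerivWithin (Ico 0 T) θ t x / θ t x +
        ((v 0 - u t x 0) * Torus.timeDerivWithin (Ico 0 T) (fun s y => u s y 0) t x +
          (v 1 - u t x 1) * Torus.timeDerivWithin (Ico 0 T) (fun s y => u s y 1) t x +
          (v 2 - u t x 2) * Torus.timeDerivWithin (Ico 0 T) (fun s y => u s y 2) t x) / θ t x +
        ((v 0 - u t x 0) ^ 2 + (v 1 - u t x 1) ^ 2 + (v 2 - u t x 2) ^ 2) *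
          Torus.timeDerivWithin (Ico 0 T) θ t x / (2 * θ t x ^ 2) := by
    refine timeDerivWithin_eq_of_hasDerivWithinAt (((sA.fun_sub
      (((sθ.const_mul (2 * Real.pi)).log (h2πθ0 x)).const_mul (3 / 2))).fun_sub
      ((((((su 0).const_sub (v 0)).fun_pow 2).fun_add (((su 1).const_sub (v 1)).fun_pow 2)).fun_add
        (((su 2).const_sub (v 2)).fun_pow 2)).fun_div (sθ.const_mul 2) (h2θ0 x))).congr_deriv ?_) (hU t ht)
    field_simp
    ring
  -- (2) the partial derivatives of `g`
  have hgk : ∀ k, Torus.partialDeriv k (fun y => Real.log (a t y) -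
      3 / 2 * Real.log (2 * Real.pi * θ t y) -
      ((v 0 - u t y 0) ^ 2 + (v 1 - u t y 1) ^ 2 + (v 2 - u t y 2) ^ 2) / (2 * θ t y)) x =
      Torus.partialDeriv k (fun y => Real.log (a t y)) x -
        3 / 2 * Torus.partialDeriv k (θ t) x / θ t x +
        ((v 0 - u t x 0) * Torus.partialDeriv k (fun y => u t y 0) x +
          (v 1 - u t x 1) * Torus.partialDeriv k (fun y => u t y 1) x +
          (v 2 - u t x 2) * Torus.partialDeriv k (fun y => u t y 2) x) / θ t x +
        ((v 0 - u t x 0) ^ 2 + (v 1 - u t x 1) ^ 2 + (v 2 - u t x 2) ^ 2) *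
          Torus.partialDeriv k (θ t) x / (2 * θ t x ^ 2) := by
    intro k
    refine partialDeriv_eq_of_hasDerivAt ((((cA k).fun_sub
      ((((cθ k).const_mul (2 * Real.pi)).log (h2πθ0 _)).const_mul (3 / 2))).fun_sub
      ((((((cu k 0).const_sub (v 0)).fun_pow 2).fun_add (((cu k 1).const_sub (v 1)).fun_pow 2)).fun_add
        (((cu k 2).const_sub (v 2)).fun_pow 2)).fun_div ((cθ k).const_mul 2) (h2θ0 _))).congr_deriv ?_)
    simp only [zero_smul, Torus.proj_zero, add_zero]
    field_simp
    ring
  rw [hgt]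
  simp only [Fin.sum_univ_three, hgk]
  -- (3) the primitive equations
  have hP2 := fun j => hE.density_mul_timeDeriv_velocity_eq hJ hζ hρJ hp ht x j
  have hP3 := hE.timeDeriv_temperature_eq hJ hζ hρJ hp ht x
  have hut : ∀ j, Torus.timeDerivWithin (Ico 0 T) (fun s y => u s y j) t x =
      (-(ρ t x * ∑ i, u t x i * Torus.partialDeriv i (fun y => u t y j) x) -
        (θ t x * (ζ (ρ t x) + ρ t x * deriv ζ (ρ t x)) * Torus.partialDeriv j (ρ t) x +
          ρ t x * ζ (ρ t x) * Torus.partialDeriv j (θ t) x)) / ρ t x := fun j =>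
    eq_div_of_mul_eq hρ0 ((mul_comm _ _).trans (hP2 j))
  simp only [Fin.sum_univ_three] at hP3 hut
  rw [hP3, hut 0, hut 1, hut 2]
  field_simp
  ring

end Summit.AtomisticToContinuum.HydrodynamicLimit.Theorems.ClampedCurrentsDockStreaming

end
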